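import Literature.Topology.Euclidean.LatticeCubeApproxStep
import HarnessLib

/-!
# Cellular approximation on lattice cube complexes, II: the induction and the theorem

Topic `Literature/Topology/Euclidean`, continuing `LatticeCubeApproxStep.lean`. We assemble
stage `n + 1` from stage `n` by gluing the face extensions over the `(n + 1)`-faces
(`LatticeCube.approxData_succ`), iterate from the vertices up to dimension `N`
(`LatticeCube.approxData_all`), and state the result:

* `LatticeCube.exists_cellular_close` (**cellular approximation with control**, after Hatcher,
  *Algebraic Topology* (2002), Thm. 4.8 and its proof): under `LatticeCube.ApproxHyp 𝒬 h e η R`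
  with `R ≥ h + N (2η + h) + η + h`, there is a map `g`, continuous on `K = complex 𝒬 h`,
  mapping every closed `m`-face of `K` into the `m`-skeleton, with `dist (g x) (e x) ≤
  h + N (2η + h)` on `K`; in particular (`LatticeCube.segment_subset_complex_of_thick`) the
  segments `[g x, e x]` lie in `K`.

No `sorry`; [folklore] packaging of Hatcher's argument.

## References

* A. Hatcher, *Algebraic Topology*, CUP (2002), §4.1, Thm. 4.8 and its proof (pp. 349–351);
  Appendix, Prop. A.11 (where it is applied to `ir`). [HatcherAT2002]
-/

noncomputable section

open Set Metric Topology Function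

namespace Literature.Topology.Euclidean

namespace LatticeCube

variable {N : ℕ} {h : ℝ} {𝒬 : Finset (Fin N → ℤ)} {e : (Fin N → ℝ) → (Fin N → ℝ)} {η R : ℝ}

/-! ### Stage `n + 1` from stage `n` -/

/-- The `(n + 1)`-skeleton is the `n`-skeleton together with the closed `(n + 1)`-faces.
[folklore] -/
theorem skel_succ_eq (n : ℕ) : skel 𝒬 h (n + 1) =
    skel 𝒬 h n ∪ ⋃ F ∈ {F : Face N | F ∈ faces 𝒬 ∧ F.S.card = n + 1}, F.carrier h := by
  ext x
  simp only [mem_union, mem_iUnion, mem_setOf_eq, exists_prop]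
  constructor
  · intro hx
    obtain ⟨F, hF, hFn, hxF⟩ := mem_skel.1 hx
    rcases hFn.lt_or_eq with hlt | heq
    · exact Or.inl (mem_skel.2 ⟨F, hF, by omega, hxF⟩)
    · exact Or.inr ⟨F, ⟨hF, heq⟩, hxF⟩
  · rintro (hx | ⟨F, ⟨hF, hFn⟩, hxF⟩)
    · exact skel_mono (Nat.le_succ n) hx
    · exact mem_skel.2 ⟨F, hF, hFn.le, hxF⟩

/-- A point of a closed `(n + 1)`-face of the complex off the `n`-skeleton lies in the open
face. [folklore] -/
theorem mem_relint_of_not_mem_skel {n : ℕ} {F : Face N} (hF : F ∈ faces 𝒬) (hFn : F.S.card = n + 1)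
    {x : Fin N → ℝ} (hx : x ∈ F.carrier h) (hxn : x ∉ skel 𝒬 h n) : x ∈ F.relint h := by
  by_contra hx'
  exact hxn (Face.mem_skel_of_mem_carrier_diff_relint hF hFn.le hx hx')

/-- **Stage `n + 1` from stage `n`** (Hatcher 2002, proof of Thm. 4.8, the inductive step): glue
the extensions over the `(n + 1)`-faces (`face_extension`) to stage `n`; the distance bound
grows by `2η + h`. [cite: HatcherAT2002, Thm. 4.8 (proof)] -/
theorem approxData_succ (H : ApproxHyp 𝒬 h e η R) {n : ℕ} {D : ℝ} (hD : 0 ≤ D)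
    (A : ApproxData 𝒬 h e n D) (hn : n + 1 ≤ N) (hR : D + η + h ≤ R) :
    Nonempty (ApproxData 𝒬 h e (n + 1) (D + 2 * η + h)) := by
  classical
  have hh := H.hh
  -- the `(n + 1)`-faces and their extensions
  set 𝓕 : Set (Face N) := {F | F ∈ faces 𝒬 ∧ F.S.card = n + 1} with h𝓕
  have h𝓕f : 𝓕.Finite := (faces_finite 𝒬).subset fun F hF => hF.1
  haveI : Finite 𝓕 := h𝓕f.to_subtype
  have hex : ∀ F : 𝓕, ∃ Φ : (Fin (n + 1) → ℝ) → (Fin N → ℝ), ContinuousOn Φ (closedBall 0 1) ∧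
      MapsTo Φ (closedBall 0 1) (skel 𝒬 h (n + 1)) ∧ IsC1Covered (n + 1) (Φ '' closedBall 0 1) ∧
      (∀ w ∈ sphere (0 : Fin (n + 1) → ℝ) 1, Φ w = A.g (F.1.param h F.2.2 w)) ∧
      (∀ w ∈ closedBall (0 : Fin (n + 1) → ℝ) 1, dist (Φ w) (e (F.1.cornerPoint h)) ≤ D + η + h) :=
    fun F => face_extension H hD A hn hR F.2.1 F.2.2
  choose Φ hΦc hΦs hΦsm hΦbd hΦdist using hex
  -- the glued map
  let g' : (Fin N → ℝ) → (Fin N → ℝ) := fun x =>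
    if x ∈ skel 𝒬 h n then A.g x
    else if hx : ∃ F : 𝓕, x ∈ F.1.relint h then Φ hx.choose (hx.choose.1.coord h hx.choose.2.2 x)
    else A.g x
  have hg'_skel : ∀ x ∈ skel 𝒬 h n, g' x = A.g x := fun x hx => by simp [g', hx]
  -- on each closed `(n + 1)`-face, `g'` is the extension read through the chart
  have hg'_face : ∀ (F : 𝓕), ∀ x ∈ F.1.carrier h, g' x = Φ F (F.1.coord h F.2.2 x) := by
    intro F x hx
    by_cases hxn : x ∈ skel 𝒬 h n
    · -- boundary point: `coord x` on the sphere, both sides are `g x`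
      have hx' : x ∉ F.1.relint h := fun hr =>
        Face.not_mem_skel_of_mem_relint hh (by rw [F.2.2]; omega) hr hxn
      rw [hg'_skel x hxn, hΦbd F _ (mem_sphere_zero_iff_norm.2
        (F.1.norm_coord_eq_one_of_not_mem_relint hh F.2.2 hx hx')), Face.param_coord hh hx]
    · have hxr : x ∈ F.1.relint h := mem_relint_of_not_mem_skel F.2.1 F.2.2 hx hxn
      have hex' : ∃ F' : 𝓕, x ∈ F'.1.relint h := ⟨F, hxr⟩
      have hF' : hex'.choose = F := by
        apply Subtype.ext
        exact (Face.eq_of_mem_relint_of_mem_carrier hh hex'.choose_spec hx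
          (by rw [F.2.2, hex'.choose.2.2])).symm
      simp only [g', hxn, if_false, dif_pos hex']
      -- rewrite the chosen face to `F`
      have key : ∀ (F' : 𝓕) (hF' : F' = F), Φ F' (F'.1.coord h F'.2.2 x) = Φ F (F.1.coord h F.2.2 x) := by
        rintro F' rfl; rfl
      exact key _ hF'
  -- continuity on the `(n + 1)`-skeleton: closed finite cover by `skel n` and the faces
  have hcont : ContinuousOn g' (skel 𝒬 h (n + 1)) := by
    have hcov : skel 𝒬 h (n + 1) ⊆ ⋃ o : Option 𝓕, Option.elim o (skel 𝒬 h n) fun F => F.1.carrier h := by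
      intro x hx
      rw [skel_succ_eq] at hx
      rcases hx with hx | hx
      · exact mem_iUnion.2 ⟨none, hx⟩
      · simp only [mem_iUnion, mem_setOf_eq, exists_prop] at hx
        obtain ⟨F, hF, hxF⟩ := hx
        exact mem_iUnion.2 ⟨some ⟨F, hF⟩, hxF⟩
    refine ContinuousOn.mono ?_ hcov
    refine (locallyFinite_of_finite _).continuousOn_iUnion (fun o => ?_) fun o => ?_
    · cases o with
      | none => exact isClosed_skel n
      | some F => exact F.1.isClosed_carrier h
    · cases o with
      | none => exact A.continuousOn.congr fun x hx => hg'_skel x hx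
      | some F =>
        refine ((hΦc F).comp Face.continuous_coord.continuousOn fun x hx =>
          Face.coord_mem_closedBall hh hx).congr fun x hx => hg'_face F x hx
  refine ⟨⟨g', hcont, ?_, ?_, ?_⟩⟩
  · -- cellularity on faces of dimension `≤ n + 1`
    intro F hF hFn x hx
    rcases hFn.lt_or_eq with hlt | heq
    · rw [hg'_skel x (carrier_subset_skel hF (by omega) hx)]
      exact A.mapsTo F hF (by omega) hx
    · rw [hg'_face ⟨F, hF, heq⟩ x hx]
      obtain ⟨F', hF', hF'c, hmem⟩ := mem_skel.1 (hΦs ⟨F, hF, heq⟩ (Face.coord_mem_closedBall hh hx))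
      exact mem_skel.2 ⟨F', hF', by omega, hmem⟩
  · -- smallness of face images
    intro F hF hFn
    rcases hFn.lt_or_eq with hlt | heq
    · have : g' '' F.carrier h = A.g '' F.carrier h :=
        image_congr fun x hx => hg'_skel x (carrier_subset_skel hF (by omega) hx)
      rw [this]
      exact A.small F hF (by omega)
    · rw [heq]
      refine (hΦsm ⟨F, hF, heq⟩).mono ?_
      rintro _ ⟨x, hx, rfl⟩
      rw [hg'_face ⟨F, hF, heq⟩ x hx]
      exact ⟨_, Face.coord_mem_closedBall hh hx, rfl⟩
  · -- distance control
    intro x hx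
    by_cases hxn : x ∈ skel 𝒬 h n
    · rw [hg'_skel x hxn]
      linarith [A.dist_le x hxn, H.hη, hh.le]
    · rw [skel_succ_eq] at hx
      rcases hx with hx | hx
      · exact absurd hx hxn
      · simp only [mem_iUnion, mem_setOf_eq, exists_prop] at hx
        obtain ⟨F, hF, hxF⟩ := hx
        rw [hg'_face ⟨F, hF⟩ x hxF]
        have hxK : x ∈ complex 𝒬 h := carrier_subset_complex hh.le hF.1 hxF
        have hcK : F.cornerPoint h ∈ complex 𝒬 h :=
          carrier_subset_complex hh.le hF.1 (Face.cornerPoint_mem_carrier (G := F) hh.le)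
        calc dist (Φ ⟨F, hF⟩ (F.coord h hF.2 x)) (e x)
            ≤ dist (Φ ⟨F, hF⟩ (F.coord h hF.2 x)) (e (F.cornerPoint h)) + dist (e (F.cornerPoint h)) (e x) :=
              dist_triangle _ _ _
          _ ≤ (D + η + h) + η := add_le_add (hΦdist ⟨F, hF⟩ _ (Face.coord_mem_closedBall hh hxF))
              (H.osc _ hcK _ hxK (Face.dist_le_of_mem_carrier (G := F) hh.le
                (Face.cornerPoint_mem_carrier (G := F) hh.le) hxF))
          _ = D + 2 * η + h := by ring

/-! ### All stages, and the theorem -/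

/-- **All stages**: under the hypotheses with `R ≥ h + N (2η + h) + η + h`, stage `n` exists with
distance bound `h + n (2η + h)` for every `n ≤ N`. [folklore] -/
theorem approxData_all (H : ApproxHyp 𝒬 h e η R) (hR : h + N * (2 * η + h) + η + h ≤ R) :
    ∀ n : ℕ, n ≤ N → Nonempty (ApproxData 𝒬 h e n (h + n * (2 * η + h))) := by
  have hh := H.hh
  have hη := H.hη
  have hN : (0 : ℝ) ≤ N := Nat.cast_nonneg N
  intro n
  induction n with
  | zero =>
    intro _
    simpa using approxData_zero H (by nlinarith)
  | succ n ih =>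
    intro hn
    obtain ⟨A⟩ := ih (by omega)
    have hnN : (n : ℝ) + 1 ≤ N := by exact_mod_cast hn
    have hD : 0 ≤ h + n * (2 * η + h) := by positivity
    have hR' : h + n * (2 * η + h) + η + h ≤ R := by nlinarith
    obtain ⟨A'⟩ := approxData_succ H hD A hn hR'
    refine ⟨⟨A'.g, A'.continuousOn, A'.mapsTo, A'.small, fun x hx => (A'.dist_le x hx).trans ?_⟩⟩
    push_cast
    ring_nf
    exact le_rfl

/-- **Cellular approximation with control on a lattice cube complex** (after Hatcher 2002,
Thm. 4.8: "Every map `f : X → Y` of CW complexes is homotopic to a cellular map", proof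
pp. 349–351, here for a self-map of a finite cube complex and with the distance control that
keeps the homotopy inside the complex). Under `ApproxHyp 𝒬 h e η R` (`h > 0`, `η ≥ 0`, `e`
oscillates by `≤ η` at scale `h` on `K = complex 𝒬 h`, `K` contains the lattice cubes meeting
the `R`-balls around the values `e x`) with `R ≥ h + N (2η + h) + η + h`, there is `g`,
continuous on `K`, mapping every closed `m`-face of `K` into `skel 𝒬 h m`, with
`dist (g x) (e x) ≤ h + N (2η + h)` for `x ∈ K`. [cite: HatcherAT2002, Thm. 4.8] -/
theorem exists_cellular_close (H : ApproxHyp 𝒬 h e η R) (hR : h + N * (2 * η + h) + η + h ≤ R) :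
    ∃ g : (Fin N → ℝ) → (Fin N → ℝ), ContinuousOn g (complex 𝒬 h) ∧
      (∀ F ∈ faces 𝒬, MapsTo g (F.carrier h) (skel 𝒬 h F.S.card)) ∧
      ∀ x ∈ complex 𝒬 h, dist (g x) (e x) ≤ h + N * (2 * η + h) := by
  obtain ⟨A⟩ := approxData_all H hR N le_rfl
  have hskel : skel 𝒬 h N = complex 𝒬 h := skel_eq_complex H.hh.le le_rfl
  refine ⟨A.g, hskel ▸ A.continuousOn, fun F hF => A.mapsTo F hF ?_, fun x hx => A.dist_le x ?_⟩
  · simpa using Finset.card_le_univ F.S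
  · rwa [hskel]

/-- **Segments to close points stay in a thick complex**: under `ApproxHyp` with `D + h ≤ R`,
`D ≥ 0`, if `dist y (e x) ≤ D` for some `x ∈ K` then the whole segment `[y, e x]` lies in `K`
(it lies in `closedBall (e x) D`, inside the lattice box around that ball, inside `K`).
[folklore] -/
theorem segment_subset_complex_of_thick (H : ApproxHyp 𝒬 h e η R) {D : ℝ} (hD : 0 ≤ D)
    (hR : D + h ≤ R) {x : Fin N → ℝ} (hx : x ∈ complex 𝒬 h) {y : Fin N → ℝ}
    (hy : dist y (e x) ≤ D) : segment ℝ y (e x) ⊆ complex 𝒬 h := by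
  have hh := H.hh
  have hB : box (boxLo (e x) D h) (boxHi (e x) D h) h ⊆ complex 𝒬 h :=
    boxAround_subset_complex hh (e x) hD fun b hb => H.thick x hx b
      (hb.mono (inter_subset_inter_right _ (closedBall_subset_closedBall hR)))
  refine Subset.trans ?_ ((closedBall_subset_box hh (e x) D).trans hB)
  exact (convex_closedBall (e x) D).segment_subset (mem_closedBall.2 hy) (mem_closedBall_self hD)

end LatticeCube

end Literature.Topology.Euclidean

end
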